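import Mathlib
import Summits.NavierStokesRegularity.NavierStokesRegularity.Theorems.TaylorModelRungThreeCertificateIntervalD
import HarnessLib

/-!
# Certificate glue on a shift set `𝕊`, XXXVIII-a: SPARSE INTERVAL ROWS — the data structure of the sparse-Jacobian variational kernel
  (helper for items stmt-NavierStokesRegularity-22987 `FlatGapCertificatesV2` (crux K_A♭ of route TaoLadderRungTwoFlat) and stmt-24295 K_A₂(64);
  cell harvest/h2-tao-ladder, p1 g18; PERFORMANCE refactor of the step checker: the 98 per-column variational jets of `vcolsA` (≈ 25 of the
  ≈ 26 CPU-min of one `checkStepG` at `n = 98`, `p = 16`) are replaced by ONE matrix recursion over sparse interval Jacobians)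

A SPARSE INTERVAL ROW is a list of pairs `(e, B)` (column index, box). This file: `insertAcc` / `mergeRow` (merge equal indices with
rounded sums), `rowApply` (apply a row to a column reader, rounded), and their SOUNDNESS through DECORATED rows `σ : List (ℕ × ℝ × IntervalD)`
carrying a real witness per entry: `projRow`, `valRow`, `OkRow`, the decorated twins `insertAccD` / `mergeRowD` with the commutation lemmas
`projRow_insertAccD` / `projRow_mergeRowD`, value preservation `valRow_insertAccD` / `valRow_mergeRowD`, and `mem_rowApply`
(`Σ r_t · v_{e_t} ∈ rowApply V (projRow σ)` when `r_t ∈ B_t` and `v_e ∈ V e`).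

HONEST FRAMING: generic interval-arithmetic bookkeeping (pub-ns-dss's `IntervalD`); no field, no certificate data, nothing certified, no stub closed,
nothing here is a statement about the Navier–Stokes equations.
-/

-- the sub-problem namespace repeats the summit name by design (D-0017)
set_option linter.dupNamespace false

namespace Summit.NavierStokesRegularity.NavierStokesRegularity.Theorems

open Summit.NavierStokesRegularity.NavierStokesRegularity.Theorems.TaylorModelCert

namespace CertificateGlueOn

/-! ### Sparse interval rows: the executable side -/

/-- Accumulate the entry `(e, B)` into a sparse row: add `B` (rounded) to the box at index `e` if present, else append it. [folklore] -/
def insertAcc (prec : ℕ) (e : ℕ) (B : IntervalD) : List (ℕ × IntervalD) → List (ℕ × IntervalD)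
  | [] => [(e, B)]
  | p :: l => if p.1 = e then (e, IntervalD.addR prec p.2 B) :: l else p :: insertAcc prec e B l

/-- Merge the entries of a sparse row with equal index (rounded sums). [folklore] -/
def mergeRow (prec : ℕ) : List (ℕ × IntervalD) → List (ℕ × IntervalD)
  | [] => []
  | p :: l => insertAcc prec p.1 p.2 (mergeRow prec l)

/-- Apply a sparse interval row to a column reader: the rounded sum `Σ_{(e,B)} B ⊗ V e`. [folklore] -/
def rowApply (prec : ℕ) (V : ℕ → IntervalD) : List (ℕ × IntervalD) → IntervalD
  | [] => IntervalD.ofInt 0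
  | p :: l => IntervalD.addR prec (IntervalD.mulR prec p.2 (V p.1)) (rowApply prec V l)

/-! ### Decorated rows: the proof side -/

/-- The sparse row of a decorated row (forget the real witnesses). [folklore] -/
def projRow (σ : List (ℕ × ℝ × IntervalD)) : List (ℕ × IntervalD) := σ.map fun t => (t.1, t.2.2)

/-- The linear functional `v ↦ Σ_t r_t · v (e_t)` of a decorated row. [folklore] -/
noncomputable def valRow (σ : List (ℕ × ℝ × IntervalD)) (v : ℕ → ℝ) : ℝ := (σ.map fun t => t.2.1 * v t.1).sum

/-- Every real witness lies in its box. [folklore] -/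
def OkRow (σ : List (ℕ × ℝ × IntervalD)) : Prop := ∀ t ∈ σ, IntervalD.mem t.2.1 t.2.2

/-- `projRow` of a cons. [folklore] -/
@[simp] theorem projRow_cons (t : ℕ × ℝ × IntervalD) (σ : List (ℕ × ℝ × IntervalD)) : projRow (t :: σ) = (t.1, t.2.2) :: projRow σ := rfl

/-- `projRow []`. [folklore] -/
@[simp] theorem projRow_nil : projRow [] = [] := rfl

/-- `valRow` of a cons. [folklore] -/
@[simp] theorem valRow_cons (t : ℕ × ℝ × IntervalD) (σ : List (ℕ × ℝ × IntervalD)) (v : ℕ → ℝ) :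
    valRow (t :: σ) v = t.2.1 * v t.1 + valRow σ v := by
  simp [valRow]

/-- `valRow []`. [folklore] -/
@[simp] theorem valRow_nil (v : ℕ → ℝ) : valRow [] v = 0 := by simp [valRow]

/-- `valRow` of an append. [folklore] -/
theorem valRow_append (σ τ : List (ℕ × ℝ × IntervalD)) (v : ℕ → ℝ) : valRow (σ ++ τ) v = valRow σ v + valRow τ v := by
  simp [valRow, List.map_append, List.sum_append]

/-- `projRow` of an append. [folklore] -/
theorem projRow_append (σ τ : List (ℕ × ℝ × IntervalD)) : projRow (σ ++ τ) = projRow σ ++ projRow τ := by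
  simp [projRow, List.map_append]

/-- `OkRow` of a cons. [folklore] -/
theorem okRow_cons {t : ℕ × ℝ × IntervalD} {σ : List (ℕ × ℝ × IntervalD)} (ht : IntervalD.mem t.2.1 t.2.2) (hσ : OkRow σ) :
    OkRow (t :: σ) := by
  intro s hs
  rcases List.mem_cons.1 hs with rfl | hs
  · exact ht
  · exact hσ s hs

/-- `OkRow` of an append. [folklore] -/
theorem okRow_append {σ τ : List (ℕ × ℝ × IntervalD)} (hσ : OkRow σ) (hτ : OkRow τ) : OkRow (σ ++ τ) := by
  intro s hs
  rcases List.mem_append.1 hs with hs | hs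
  · exact hσ s hs
  · exact hτ s hs

/-- Decorated accumulation: the real witnesses add where the boxes add. [folklore] -/
noncomputable def insertAccD (prec : ℕ) (e : ℕ) (r : ℝ) (B : IntervalD) : List (ℕ × ℝ × IntervalD) → List (ℕ × ℝ × IntervalD)
  | [] => [(e, r, B)]
  | t :: l => if t.1 = e then (e, t.2.1 + r, IntervalD.addR prec t.2.2 B) :: l else t :: insertAccD prec e r B l

/-- Decorated merge. [folklore] -/
noncomputable def mergeRowD (prec : ℕ) : List (ℕ × ℝ × IntervalD) → List (ℕ × ℝ × IntervalD)
  | [] => []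
  | t :: l => insertAccD prec t.1 t.2.1 t.2.2 (mergeRowD prec l)

/-- **`insertAcc` commutes with forgetting the witnesses.** [folklore] -/
theorem projRow_insertAccD (prec : ℕ) (e : ℕ) (r : ℝ) (B : IntervalD) :
    ∀ σ : List (ℕ × ℝ × IntervalD), projRow (insertAccD prec e r B σ) = insertAcc prec e B (projRow σ)
  | [] => rfl
  | t :: l => by
    by_cases h : t.1 = e
    · simp only [insertAccD, if_pos h, projRow_cons, insertAcc]
    · simp only [insertAccD, if_neg h, projRow_cons, insertAcc, projRow_insertAccD prec e r B l]

/-- **`insertAcc` adds the functional `r · v e`.** [folklore] -/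
theorem valRow_insertAccD (prec : ℕ) (e : ℕ) (r : ℝ) (B : IntervalD) (v : ℕ → ℝ) :
    ∀ σ : List (ℕ × ℝ × IntervalD), valRow (insertAccD prec e r B σ) v = r * v e + valRow σ v
  | [] => by simp [insertAccD]
  | t :: l => by
    by_cases h : t.1 = e
    · simp only [insertAccD, h, ↓reduceIte, valRow_cons]; ring
    · simp only [insertAccD, if_neg h, valRow_cons, valRow_insertAccD prec e r B v l]; ring

/-- `insertAcc` keeps the witnesses in their boxes. [folklore] -/
theorem okRow_insertAccD (prec : ℕ) {e : ℕ} {r : ℝ} {B : IntervalD} (hr : IntervalD.mem r B) :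
    ∀ {σ : List (ℕ × ℝ × IntervalD)}, OkRow σ → OkRow (insertAccD prec e r B σ)
  | [], _ => fun s hs => by
    simp only [insertAccD, List.mem_singleton] at hs
    subst hs; exact hr
  | t :: l, h => by
    by_cases hte : t.1 = e
    · simp only [insertAccD, if_pos hte]
      exact okRow_cons (IntervalD.mem_addR prec (h t List.mem_cons_self) hr) fun s hs => h s (List.mem_cons_of_mem t hs)
    · simp only [insertAccD, if_neg hte]
      exact okRow_cons (h t List.mem_cons_self) (okRow_insertAccD prec hr fun s hs => h s (List.mem_cons_of_mem t hs))

/-- `insertAcc` introduces no new index beyond `e`. [folklore] -/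
theorem bound_insertAccD (prec : ℕ) {n e : ℕ} (he : e < n) {r : ℝ} {B : IntervalD} :
    ∀ {σ : List (ℕ × ℝ × IntervalD)}, (∀ t ∈ σ, t.1 < n) → ∀ t ∈ insertAccD prec e r B σ, t.1 < n
  | [], _ => fun s hs => by
    simp only [insertAccD, List.mem_singleton] at hs
    subst hs; exact he
  | t :: l, h => by
    intro s hs
    by_cases hte : t.1 = e
    · simp only [insertAccD, if_pos hte, List.mem_cons] at hs
      rcases hs with rfl | hs
      · exact he
      · exact h s (List.mem_cons_of_mem t hs)
    · simp only [insertAccD, if_neg hte, List.mem_cons] at hs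
      rcases hs with rfl | hs
      · exact h s List.mem_cons_self
      · exact bound_insertAccD prec he (fun s' hs' => h s' (List.mem_cons_of_mem t hs')) s hs

/-- **`mergeRow` commutes with forgetting the witnesses.** [folklore] -/
theorem projRow_mergeRowD (prec : ℕ) : ∀ σ : List (ℕ × ℝ × IntervalD), projRow (mergeRowD prec σ) = mergeRow prec (projRow σ)
  | [] => rfl
  | t :: l => by
    simp only [mergeRowD, mergeRow, projRow_cons, projRow_insertAccD, projRow_mergeRowD prec l]

/-- **`mergeRow` preserves the functional.** [folklore] -/
theorem valRow_mergeRowD (prec : ℕ) (v : ℕ → ℝ) : ∀ σ : List (ℕ × ℝ × IntervalD), valRow (mergeRowD prec σ) v = valRow σ v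
  | [] => rfl
  | t :: l => by
    simp only [mergeRowD, valRow_insertAccD, valRow_cons, valRow_mergeRowD prec v l]

/-- `mergeRow` keeps the witnesses in their boxes. [folklore] -/
theorem okRow_mergeRowD (prec : ℕ) : ∀ {σ : List (ℕ × ℝ × IntervalD)}, OkRow σ → OkRow (mergeRowD prec σ)
  | [], _ => fun s hs => by simp [mergeRowD] at hs
  | t :: l, h => by
    simp only [mergeRowD]
    exact okRow_insertAccD prec (h t List.mem_cons_self) (okRow_mergeRowD prec fun s hs => h s (List.mem_cons_of_mem t hs))

/-- `mergeRow` introduces no new index. [folklore] -/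
theorem bound_mergeRowD (prec : ℕ) {n : ℕ} : ∀ {σ : List (ℕ × ℝ × IntervalD)}, (∀ t ∈ σ, t.1 < n) → ∀ t ∈ mergeRowD prec σ, t.1 < n
  | [], _ => fun s hs => by simp [mergeRowD] at hs
  | t :: l, h => by
    simp only [mergeRowD]
    exact bound_insertAccD prec (h t List.mem_cons_self) (bound_mergeRowD prec fun s hs => h s (List.mem_cons_of_mem t hs))

/-- **APPLYING A SOUND ROW IS SOUND**: `Σ_t r_t · v(e_t) ∈ rowApply V (projRow σ)` when every `r_t ∈ B_t` and `v(e_t) ∈ V(e_t)`. [folklore] -/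
theorem mem_rowApply (prec : ℕ) {V : ℕ → IntervalD} {v : ℕ → ℝ} :
    ∀ {σ : List (ℕ × ℝ × IntervalD)}, OkRow σ → (∀ t ∈ σ, IntervalD.mem (v t.1) (V t.1)) →
      IntervalD.mem (valRow σ v) (rowApply prec V (projRow σ))
  | [], _, _ => by simpa [rowApply] using IntervalD.mem_ofInt 0
  | t :: l, hσ, hv => by
    simp only [projRow_cons, rowApply, valRow_cons]
    exact IntervalD.mem_addR prec (IntervalD.mem_mulR prec (hσ t List.mem_cons_self) (hv t List.mem_cons_self))
      (mem_rowApply prec (fun s hs => hσ s (List.mem_cons_of_mem t hs)) fun s hs => hv s (List.mem_cons_of_mem t hs))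

end CertificateGlueOn

end Summit.NavierStokesRegularity.NavierStokesRegularity.Theorems
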